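import Summits.SmoothPoincare4.SmoothPoincare4.Theorems.WeakReductionDescentDependentTripleGenusThreeStandardSurgeryInversionAux2
import HarnessLib

/-!
# Crux `WeakReductionDescent.DependentTripleGenusThreeStandard` (stmt-SmoothPoincare4-18000), line
# `Sketch`: a sphere surgery of type `(3, 2)` in a 4-manifold is undone by a circle surgery

Helper file (`--supports stmt-SmoothPoincare4-18000`) of the registered skeleton
`Cruxes/DependentTripleGenusThreeStandard/Lines/Sketch.lean`, registered helper
`helper_isCircleSurgery_of_isSurgery_sphereTwo` (a piece of the apex stub's plan, Aranda–Zupan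
2025, Prop. 5.5: *"conversely, `X` is obtained by surgery on a loop in `X′`"*).

**Statement.** Let `ν : S² × ℝ² ↪ M⁴` be one framed 2-sphere (`FramedSphereFamily (𝓡 4) M Unit 2 2`)
and let `X′` be obtained from `M` by surgery along it (`ν.IsSurgery (𝓡 4) X′`: `X′` is an open
gluing of `M ∖ ν(S² × 0)` and `Unit × OD³ × S¹` along Milnor's identification
`ν(v, θ u) ∼ (θ v, u)`, `0 < θ < 1`).  Then `M` is obtained from `X′` by surgery on a circle
(`IsCircleSurgery (𝓡 4) (𝓡 4) X′ M ℓ`), namely on the core circle `ℓ = jB(⋆, 0, ·)` of the new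
piece.

**Proof (direct re-gluing; Gompf–Stipsicz 1999, §5.2; Milnor 1965, Def. 3.11).**  Write
`jA : M ∖ ν(S² × 0) ↪ X′`, `jB : Unit × OD³ × S¹ ↪ X′` for the gluing maps and
`σ(y) = y/√(1 + ‖y‖²)` for the squeeze of a Euclidean space onto its unit ball.  The tube of `ℓ` is
`νc(u, y) = jB(⋆, σ y, u)`, a `CircleNbhd` (first auxiliary file,
`SurgeryInversion.exists_circleNbhd_core`).  One has `X′ ∖ ℓ(S¹) = jA(M ∖ ν(S² × 0))` (second
auxiliary file), and `M` is the open gluing of `X′ ∖ ℓ(S¹)` — mapped to `M` by `jA⁻¹`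
(`SurgeryInversion.exists_gluingMapA`) — and `OD² × S²` — mapped to `M` by `(w, v) ↦ ν(v, σ w)`
(`SurgeryInversion.exists_gluingMapB`) — along `circleSurgeryRel νc`: for `w = t u`, `0 < t < 1`,
both `jA⁻¹(νc(u, t v))` and `ν(v, σ(t u))` equal `ν(v, θ u)` with `θ = t/√(1 + t²)`, by the
sphere-surgery relation at the parameter `θ` (`SurgeryInversion.rel_tube`); the two images cover
`M = (M ∖ ν(S² × 0)) ∪ ν(S² × 0)`.  This file assembles the gluing
(`SurgeryInversion.isCircleSurgery_core`) and derives the registered statement.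

No definition, no named fact; everything here is proved.

References: R. Gompf, A. Stipsicz, *4-Manifolds and Kirby Calculus*, GSM 20 (1999), §5.2;
J. Milnor, *Lectures on the h-cobordism theorem* (1965), Def. 3.11 (PDF p. 17); R. Aranda,
A. Zupan, arXiv:2503.04607 (2025), Prop. 5.5; A. Juhász, *Differential and Low-Dimensional
Topology* (2023), Def. 1.58.
-/

-- the registered namespace `Summit.SmoothPoincare4.SmoothPoincare4.Theorems…` repeats a component
set_option linter.dupNamespace false

noncomputable section

open scoped Manifold ContDiff Topology
open Set Function Metric Topology
open Literature.Topology.FourManifolds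

namespace Summit.SmoothPoincare4.SmoothPoincare4.Theorems

namespace SurgeryInversion

variable {M : Type*} [TopologicalSpace M] [T2Space M] [ChartedSpace (EuclideanSpace ℝ (Fin 4)) M]
  [IsManifold (𝓡 4) ∞ M] (ν : FramedSphereFamily (𝓡 4) M Unit 2 2)
  {X' : Type*} [TopologicalSpace X'] [T2Space X'] [ChartedSpace (EuclideanSpace ℝ (Fin 4)) X']
  [IsManifold (𝓡 4) ∞ X'] {jA : ↥ν.complement → X'} {jB : ↥(ballTimesSphere Unit 2 1) → X'}

/-- **A sphere surgery of type `(3, 2)` in a 4-manifold is undone by the circle surgery on the core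
circle of the new piece** (explicit gluing maps).  If `X′` is the open gluing of `M ∖ ν(S² × 0)` and
`Unit × OD³ × S¹` along Milnor's relation by `jA`, `jB`, then `M` is obtained from `X′` by surgery on
`ℓ = jB(⋆, 0, ·)`: with the tube `νc(u, y) = jB(⋆, σ y, u)` (`exists_circleNbhd_core`), `M` is the
open gluing of `X′ ∖ ℓ(S¹) = jA(M ∖ ν(S² × 0))` — by `jA⁻¹` (`exists_gluingMapA`) — and `OD² × S²`
— by `(w, v) ↦ ν(v, σ w)` (`exists_gluingMapB`) — along `circleSurgeryRel νc`: for `w = t u`,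
`0 < t < 1`, both `jA⁻¹(νc(u, t v))` and `ν(v, σ(t u))` are `ν(v, θ u)`, `θ = t/√(1 + t²)`, by the
sphere-surgery relation at the parameter `θ` (`rel_tube`); the two images cover
`M = (M ∖ ν(S² × 0)) ∪ ν(S² × 0)`. [cite: GompfStipsicz1999, §5.2] [cite: MilnorHCobordism1965, Def. 3.11 (PDF p. 17)] -/
theorem isCircleSurgery_core
    (h : IsOpenGluingWith (𝓡 4) ((𝓡 0).prod ((𝓡 3).prod (𝓡 1))) (𝓡 4) (P := X')
      (sphereFamilySurgeryRel ν) jA jB) :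
    IsCircleSurgery (𝓡 4) (𝓡 4) X' M
      (fun u => jB ⟨(DiscreteIndex.mk (), 0, u), zero_mem_ballTimesSphere u⟩) := by
  obtain ⟨hAs, hAo, hBs, hBo, hU, hR⟩ := h
  obtain ⟨νc, -, hνc⟩ := exists_circleNbhd_core jB hBs hBo
  -- `X′ ∖ ℓ(S¹) ⊆ jA(M ∖ ν(S² × 0))`
  have hsubA : (νc.complement : Set X') ⊆ range jA := by
    intro x hx
    refine mem_range_of_forall_ne ν hU hR fun b hb hbx => hx ⟨(b : DiscreteIndex Unit ×
      (EuclideanSpace ℝ (Fin 3) × (Metric.sphere (0 : EuclideanSpace ℝ (Fin 2)) 1))).2.2, ?_⟩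
    rw [← hbx]
    obtain ⟨⟨i, y, u⟩, hb'⟩ := b
    change y = 0 at hb
    subst hb
    rfl
  haveI : Nonempty ↥νc.complement :=
    ⟨⟨jA (Classical.choice (nonempty_complement ν)), fun ⟨u, hu⟩ => jA_ne_core ν hR _ _ rfl hu.symm⟩⟩
  obtain ⟨kA, hkA, hkAo, hkAj⟩ := exists_gluingMapA ν hAs hAo νc.complement hsubA
  obtain ⟨kB, hkB, hkBo, hkBf⟩ := exists_gluingMapB ν
  refine ⟨νc, kA, kB, hkA, hkAo, hkB, hkBo, ?_, fun x b => ?_⟩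
  · -- the two images cover `M`
    refine eq_univ_of_forall fun m => ?_
    by_cases hm : m ∈ ν.cores
    · obtain ⟨i, v, rfl⟩ := ν.mem_cores_iff.1 hm
      refine Or.inr ⟨⟨((0 : EuclideanSpace ℝ (Fin 2)), v), by simp⟩, ?_⟩
      rw [hkBf]
      show ν.toFun () (v, OpenPartialHomeomorph.univUnitBall 0) = ν.sphere i v
      rw [OpenPartialHomeomorph.univUnitBall_apply_zero]
      rfl
    · exact Or.inl ⟨⟨jA ⟨m, hm⟩, fun ⟨u, hu⟩ => jA_ne_core ν hR _ _ rfl hu.symm⟩, hkAj ⟨m, hm⟩ _⟩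
  · -- the gluing relation
    obtain ⟨a₀, ha₀⟩ := hsubA x.2
    have hxa : kA x = a₀ := by
      have hx' : (⟨jA a₀, ha₀.symm ▸ x.2⟩ : ↥νc.complement) = x := Subtype.ext ha₀
      rw [← hx']
      exact hkAj a₀ _
    obtain ⟨⟨w, v⟩, hb⟩ := b
    have hb' : ‖w‖ < 1 := hb
    rw [hxa, hkBf]
    dsimp only
    constructor
    · intro heq
      have hw : w ≠ 0 := by
        intro hw
        refine (ν.mem_complement_iff _).1 a₀.2 (ν.mem_cores_iff.2 ⟨(), v, ?_⟩)
        rw [ν.sphere_apply, heq, hw, OpenPartialHomeomorph.univUnitBall_apply_zero]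
      have ht0 : 0 < ‖w‖ := norm_pos_iff.2 hw
      set u : Metric.sphere (0 : EuclideanSpace ℝ (Fin 2)) 1 := ⟨‖w‖⁻¹ • w, by
        rw [mem_sphere_zero_iff_norm, norm_smul, norm_inv, norm_norm, inv_mul_cancel₀ ht0.ne']⟩ with hu
      have hwu : w = ‖w‖ • (u : EuclideanSpace ℝ (Fin 2)) := by
        rw [hu]; dsimp only; rw [smul_smul, mul_inv_cancel₀ ht0.ne', one_smul]
      refine ⟨u, ‖w‖, ⟨ht0, hb'⟩, hwu, ?_⟩
      have ha₀' : a₀ = ⟨_, tube_mem_complement ν v u ht0⟩ := by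
        refine Subtype.ext ?_
        show (a₀ : M) = ν.toFun () (v, OpenPartialHomeomorph.univUnitBall
          (‖w‖ • (u : EuclideanSpace ℝ (Fin 2))))
        rw [← hwu]
        exact heq
      show (x : X') = νc.toFun (u, ‖w‖ • (v : EuclideanSpace ℝ (Fin 3)))
      rw [hνc, ← ha₀, ha₀']
      exact (hR _ _).2 (rel_tube ν v u ht0)
    · rintro ⟨u, t, ht, hwu, hx⟩
      have key : jA ⟨_, tube_mem_complement ν v u ht.1⟩ =
          νc.toFun (u, t • (v : EuclideanSpace ℝ (Fin 3))) := by
        rw [hνc]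
        exact (hR _ _).2 (rel_tube ν v u ht.1)
      have ha₀' : a₀ = ⟨_, tube_mem_complement ν v u ht.1⟩ :=
        hAs.isEmbedding.injective (by rw [key, ha₀]; exact hx)
      rw [ha₀']
      show ν.toFun () (v, OpenPartialHomeomorph.univUnitBall (t • (u : EuclideanSpace ℝ (Fin 2)))) =
        ν.toFun () (v, OpenPartialHomeomorph.univUnitBall w)
      rw [show w = t • (u : EuclideanSpace ℝ (Fin 2)) from hwu]

end SurgeryInversion

/-- **Sphere surgery of type `(3, 2)` in a 4-manifold is undone by a circle surgery** (registered
helper `helper_isCircleSurgery_of_isSurgery_sphereTwo` of the crux skeleton; Aranda–Zupan 2025,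
Prop. 5.5: *"conversely, `X` is obtained by surgery on a loop in `X′`"*; Gompf–Stipsicz 1999, §5.2).
If `X′` is obtained from `M⁴` by surgery along one framed 2-sphere `ν : S² × ℝ² ↪ M`
(`ν.IsSurgery (𝓡 4) X′`), then `M` is obtained from `X′` by surgery on a circle — the core circle
`ℓ = jB(⋆, 0, ·)` of the new piece `OD³ × S¹` (`SurgeryInversion.isCircleSurgery_core`).
[cite: GompfStipsicz1999, §5.2] [cite: ArandaZupan2025, Prop. 5.5 (p. 19)] -/
theorem helper_isCircleSurgery_of_isSurgery_sphereTwo :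
    ∀ (M : Type) [TopologicalSpace M] [T2Space M] [SecondCountableTopology M]
      [ChartedSpace (EuclideanSpace ℝ (Fin 4)) M] [IsManifold (𝓡 4) ∞ M]
      (ν : FramedSphereFamily (𝓡 4) M Unit 2 2)
      (X' : Type) [TopologicalSpace X'] [T2Space X'] [SecondCountableTopology X']
      [ChartedSpace (EuclideanSpace ℝ (Fin 4)) X'] [IsManifold (𝓡 4) ∞ X'],
      ν.IsSurgery (𝓡 4) X' →
      ∃ ℓ : Metric.sphere (0 : EuclideanSpace ℝ (Fin 2)) 1 → X',
        IsCircleSurgery (𝓡 4) (𝓡 4) X' M ℓ := by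
  intro M _ _ _ _ _ ν X' _ _ _ _ _ hS
  obtain ⟨jA, jB, h⟩ := hS
  exact ⟨_, SurgeryInversion.isCircleSurgery_core ν h⟩

end Summit.SmoothPoincare4.SmoothPoincare4.Theorems

end
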